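import Mathlib
import Literature.Analysis.Complex.PlancherelPolyaProofs
import Summits.SmoothPoincare4.SmoothPoincare4.Theorems.SullivanDualWitnessChargeStubBubbleConfinementSubharmonic
import HarnessLib

/-!
# Stub `stub_subMeanValueLiouville` of line `Sketch`, crux `HyperbolicEnd`
(item stmt-SmoothPoincare4-7825, route `SullivanDual`): **Liouville's theorem for functions on `ℂ`
that are bounded above and have the local sub-mean-value property**

A continuous function `s : ℂ → ℝ` that is bounded above and has the local (small-radius)
sub-mean-value property at every point (`s z ≤` its average over every sufficiently small circle
about `z`) is constant.

Proof (Hadamard / harmonic-majorant argument, no potential theory). Fix `z₀`, `r > 0`, and a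
bound `m` for `s` on the circle `‖x - z₀‖ = r`. On the closed annulus `r ≤ ‖x - z₀‖ ≤ R` compare
`s` with the harmonic function `H x = m + c (log ‖x - z₀‖ - log r)`, `R` so large that
`H ≥ sup s` on the outer circle: `s - H` is continuous on the annulus, `≤ 0` on both boundary
circles, and has the local sub-mean-value property in the open annulus (mean value property of
harmonic functions, Mathlib's `HarmonicOnNhd.circleAverage_eq`; harmonicity of `H` off `z₀` is
the sibling crux's `harmonicAt_logComparison`, from Mathlib's `AnalyticAt.harmonicAt_log_norm`),
so the tree's weak maximum principle
`Literature.Analysis.Complex.le_on_of_subMeanValue_of_le_on_boundary` gives `s ≤ H` on the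
annulus (`le_logMajorant_of_subMeanValue`). Letting `c → 0` (and `R → ∞` accordingly) gives
`s z ≤ m` whenever `‖z - z₀‖ > r` (`le_of_le_on_sphere_of_subMeanValue`); letting `r → 0` and
using continuity at `z₀`, `s z ≤ s z₀` for all `z, z₀`, whence `s` is constant.

References: T. Ransford, *Potential theory in the complex plane*, LMS Student Texts 28 (1995),
Thm. 2.3.1 (maximum principle) and the Liouville theorem for subharmonic functions bounded above
on `ℂ` [Ransford1995].
-/

noncomputable section

-- the prescribed crux namespace repeats the component `SmoothPoincare4`
set_option linter.dupNamespace false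

open scoped Manifold ContDiff Topology
open Laplacian Set
open Metric InnerProductSpace
-- `harmonicAt_logComparison`: `a + c (log ‖y - z₀‖ - log r)` is harmonic off `z₀`
open Summit.SmoothPoincare4.SmoothPoincare4.Theorems.WitnessCharge.PencilIncompleteness
  (harmonicAt_logComparison)

namespace Summit.SmoothPoincare4.SmoothPoincare4.Cruxes.HyperbolicEnd.Sketch

/-- **Annulus comparison.** Let `s` be continuous on `ℂ`, bounded above by `M`, with the local
sub-mean-value property, and `s ≤ m` on the circle `‖x - z₀‖ = r` (`r > 0`). If
`M ≤ m + c (log R - log r)`, then `s z ≤ m + c (log ‖z - z₀‖ - log r)` for `r < ‖z - z₀‖ ≤ R`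
(weak maximum principle for `s - H`, `H = m + c (log ‖· - z₀‖ - log r)` harmonic, on the closed
annulus). [cite: Ransford1995, Thm. 2.3.1] -/
theorem le_logMajorant_of_subMeanValue {s : ℂ → ℝ} (hc : Continuous s) {M : ℝ}
    (hM : ∀ z, s z ≤ M)
    (hsub : ∀ z : ℂ, ∃ r₀ : ℝ, 0 < r₀ ∧ ∀ r ∈ Ioo 0 r₀, s z ≤ Real.circleAverage s z r)
    {z₀ : ℂ} {r m : ℝ} (hr : 0 < r) (hm : ∀ x ∈ sphere z₀ r, s x ≤ m) {c R : ℝ}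
    (hR : M ≤ m + c * (Real.log R - Real.log r)) {z : ℂ} (hz : r < ‖z - z₀‖)
    (hzR : ‖z - z₀‖ ≤ R) : s z ≤ m + c * (Real.log ‖z - z₀‖ - Real.log r) := by
  set H : ℂ → ℝ := fun x => m + c * (Real.log ‖x - z₀‖ - Real.log r) with hH_def
  set K : Set ℂ := {x | r ≤ ‖x - z₀‖ ∧ ‖x - z₀‖ ≤ R} with hK_def
  set B : Set ℂ := {x | ‖x - z₀‖ = r ∨ ‖x - z₀‖ = R} with hB_def
  have hnc : Continuous fun x : ℂ => ‖x - z₀‖ := (continuous_id.sub continuous_const).norm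
  have hK : IsCompact K := by
    apply Metric.isCompact_of_isClosed_isBounded
    · exact isClosed_Icc.preimage hnc
    · refine (isBounded_closedBall (x := z₀) (r := R)).subset fun x hx => ?_
      rw [mem_closedBall, dist_eq_norm]
      exact hx.2
  -- points of `K` are off `z₀`, so `H` is harmonic near each of them
  have hKz₀ : ∀ x ∈ K, x ≠ z₀ := by
    intro x hx h
    have hx1 : r ≤ ‖x - z₀‖ := hx.1
    rw [h, sub_self, norm_zero] at hx1
    linarith
  have hHK : ∀ x ∈ K, HarmonicAt H x := fun x hx => harmonicAt_logComparison m c r (hKz₀ x hx)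
  have hu : ContinuousOn (fun y => s y - H y) K := fun x hx =>
    (hc.continuousAt.sub (hHK x hx).1.continuousAt).continuousWithinAt
  -- the local sub-mean-value property of `s - H` in the open annulus
  have hsub' : ∀ x ∈ K \ B, ∃ ρ₀ > 0, closedBall x ρ₀ ⊆ K ∧
      ∀ ρ ∈ Ioo 0 ρ₀, (fun y => s y - H y) x ≤ Real.circleAverage (fun y => s y - H y) x ρ := by
    intro x hx
    have hxK : x ∈ K := hx.1
    have hxB : x ∉ B := hx.2
    have hx1 : r < ‖x - z₀‖ := lt_of_le_of_ne hxK.1 fun h => hxB (Or.inl h.symm)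
    have hx2 : ‖x - z₀‖ < R := lt_of_le_of_ne hxK.2 fun h => hxB (Or.inr h)
    obtain ⟨r₀, hr₀, hsx⟩ := hsub x
    obtain ⟨ρ₀, hρ₀, hρ₀r₀, hρ₀1, hρ₀2⟩ :
        ∃ ρ₀ : ℝ, 0 < ρ₀ ∧ ρ₀ ≤ r₀ ∧ ρ₀ ≤ ‖x - z₀‖ - r ∧ ρ₀ ≤ R - ‖x - z₀‖ :=
      ⟨min r₀ (min (‖x - z₀‖ - r) (R - ‖x - z₀‖)),
        lt_min hr₀ (lt_min (by linarith) (by linarith)), min_le_left _ _,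
        (min_le_right _ _).trans (min_le_left _ _), (min_le_right _ _).trans (min_le_right _ _)⟩
    have hball : closedBall x ρ₀ ⊆ K := by
      intro y hy
      rw [mem_closedBall, dist_eq_norm] at hy
      constructor
      · have h1 := norm_sub_norm_le (x - z₀) (x - y)
        have h2 : x - z₀ - (x - y) = y - z₀ := by ring
        rw [h2, norm_sub_rev x y] at h1
        show r ≤ ‖y - z₀‖
        linarith
      · have h1 := norm_sub_le_norm_sub_add_norm_sub y x z₀
        show ‖y - z₀‖ ≤ R
        linarith
    refine ⟨ρ₀, hρ₀, hball, fun ρ hρ => ?_⟩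
    have hρabs : |ρ| = ρ := abs_of_pos hρ.1
    have hballρ : closedBall x |ρ| ⊆ K :=
      (closedBall_subset_closedBall (hρabs.le.trans hρ.2.le)).trans hball
    have hHh : HarmonicOnNhd H (closedBall x |ρ|) := fun y hy => hHK y (hballρ hy)
    have hHi : CircleIntegrable H x ρ :=
      (hHh.continuousOn.mono sphere_subset_closedBall).circleIntegrable'
    have hsi : CircleIntegrable s x ρ := hc.continuousOn.circleIntegrable'
    show s x - H x ≤ Real.circleAverage (fun y => s y - H y) x ρ
    rw [Real.circleAverage_fun_sub hsi hHi, HarmonicOnNhd.circleAverage_eq hHh]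
    have := hsx ρ ⟨hρ.1, hρ.2.trans_le hρ₀r₀⟩
    linarith
  -- the boundary bound: `s - H ≤ 0` on both circles
  have hB : ∀ b ∈ B, (fun y => s y - H y) b ≤ 0 := by
    intro b hb
    have hb' : ‖b - z₀‖ = r ∨ ‖b - z₀‖ = R := hb
    show s b - H b ≤ 0
    rcases hb' with h | h
    · have hHb : H b = m := by simp [hH_def, h]
      have hbs : b ∈ sphere z₀ r := mem_sphere_iff_norm.2 h
      rw [hHb]
      linarith [hm b hbs]
    · have hHb : H b = m + c * (Real.log R - Real.log r) := by simp [hH_def, h]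
      rw [hHb]
      linarith [hM b]
  have hzK : z ∈ K := ⟨hz.le, hzR⟩
  have key :=
    Literature.Analysis.Complex.le_on_of_subMeanValue_of_le_on_boundary hK hu hsub' hB z hzK
  have key' : s z - H z ≤ 0 := key
  have hHz : H z = m + c * (Real.log ‖z - z₀‖ - Real.log r) := rfl
  linarith

/-- **Off a disc, `s` is bounded by its bound on the boundary circle.** Let `s` be continuous on
`ℂ`, bounded above, with the local sub-mean-value property, and `s ≤ m` on the circle
`‖x - z₀‖ = r` (`r > 0`). Then `s z ≤ m` for every `z` with `‖z - z₀‖ > r` (annulus comparison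
with `c → 0`, `R → ∞`). [cite: Ransford1995, Thm. 2.3.1] -/
theorem le_of_le_on_sphere_of_subMeanValue {s : ℂ → ℝ} (hc : Continuous s) {M : ℝ}
    (hM : ∀ z, s z ≤ M)
    (hsub : ∀ z : ℂ, ∃ r₀ : ℝ, 0 < r₀ ∧ ∀ r ∈ Ioo 0 r₀, s z ≤ Real.circleAverage s z r)
    {z₀ : ℂ} {r m : ℝ} (hr : 0 < r) (hm : ∀ x ∈ sphere z₀ r, s x ≤ m) {z : ℂ}
    (hz : r < ‖z - z₀‖) : s z ≤ m := by
  apply le_of_forall_pos_le_add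
  intro δ hδ
  have hL : 0 < Real.log ‖z - z₀‖ - Real.log r := sub_pos.2 (Real.log_lt_log hr hz)
  obtain ⟨c, hc0, hcL⟩ : ∃ c : ℝ, 0 < c ∧ c * (Real.log ‖z - z₀‖ - Real.log r) = δ :=
    ⟨δ / (Real.log ‖z - z₀‖ - Real.log r), div_pos hδ hL, div_mul_cancel₀ δ hL.ne'⟩
  obtain ⟨R, hzR, hR⟩ : ∃ R : ℝ, ‖z - z₀‖ ≤ R ∧ M ≤ m + c * (Real.log R - Real.log r) := by
    refine ⟨max ‖z - z₀‖ (Real.exp (Real.log r + (M - m) / c)), le_max_left _ _, ?_⟩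
    have h1 : Real.log r + (M - m) / c ≤
        Real.log (max ‖z - z₀‖ (Real.exp (Real.log r + (M - m) / c))) := by
      have := Real.log_le_log (Real.exp_pos (Real.log r + (M - m) / c))
        (le_max_right ‖z - z₀‖ (Real.exp (Real.log r + (M - m) / c)))
      rwa [Real.log_exp] at this
    have h2 : c * ((M - m) / c) ≤
        c * (Real.log (max ‖z - z₀‖ (Real.exp (Real.log r + (M - m) / c))) - Real.log r) :=
      mul_le_mul_of_nonneg_left (by linarith) hc0.le
    rw [mul_div_cancel₀ _ hc0.ne'] at h2
    linarith
  have key := le_logMajorant_of_subMeanValue hc hM hsub hr hm hR hz hzR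
  linarith

/-- **Liouville's theorem for functions with the sub-mean-value property.** A continuous function
on `ℂ` that is bounded above and has the local sub-mean-value property (at every point, for all
small radii, `s z ≤` its average on the circle of that radius about `z`) is constant: by
`le_of_le_on_sphere_of_subMeanValue`, `s z ≤ max_{‖x - z₀‖ = r} s` off the disc `D_r(z₀)`;
letting `r → 0`, `s z ≤ s z₀` everywhere, for every `z₀`. [cite: Ransford1995, Thm. 2.3.1] -/
theorem stub_subMeanValueLiouville : ∀ (s : ℂ → ℝ), Continuous s → BddAbove (range s) →
    (∀ z : ℂ, ∃ r₀ : ℝ, 0 < r₀ ∧ ∀ r ∈ Ioo 0 r₀, s z ≤ Real.circleAverage s z r) →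
    ∀ z w : ℂ, s z = s w := by
  intro s hc hb hsub
  obtain ⟨M, hM'⟩ := hb
  have hM : ∀ z, s z ≤ M := fun z => hM' ⟨z, rfl⟩
  -- every point is a maximum point
  have key : ∀ z₀ z : ℂ, s z ≤ s z₀ := by
    intro z₀ z
    by_cases hzz : z = z₀
    · rw [hzz]
    apply le_of_forall_pos_le_add
    intro ε hε
    obtain ⟨δ, hδ, hδs⟩ := Metric.continuous_iff.1 hc z₀ ε hε
    have hd : 0 < ‖z - z₀‖ := norm_pos_iff.2 (sub_ne_zero.2 hzz)
    obtain ⟨r, hr, hrδ, hrz⟩ : ∃ r : ℝ, 0 < r ∧ r < δ ∧ r < ‖z - z₀‖ :=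
      ⟨min (δ / 2) (‖z - z₀‖ / 2), lt_min (by positivity) (by positivity),
        (min_le_left _ _).trans_lt (by linarith), (min_le_right _ _).trans_lt (by linarith)⟩
    have hm : ∀ x ∈ sphere z₀ r, s x ≤ s z₀ + ε := by
      intro x hx
      have hxd : dist x z₀ < δ := by
        rw [mem_sphere.1 hx]
        exact hrδ
      have := hδs x hxd
      rw [Real.dist_eq] at this
      linarith [(abs_sub_lt_iff.1 this).1]
    exact le_of_le_on_sphere_of_subMeanValue hc hM hsub hr hm hrz
  intro z w
  exact le_antisymm (key w z) (key z w)

end Summit.SmoothPoincare4.SmoothPoincare4.Cruxes.HyperbolicEnd.Sketch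

end
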